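import Literature.NumberTheory.GaloisRepresentations.IntegralGaloisActionProofs
import Literature.NumberTheory.GaloisRepresentations.LocalGaloisGroupHenselProofs
import Literature.NumberTheory.GaloisRepresentations.LocalGaloisGroupProofs
import Literature.NumberTheory.GaloisRepresentations.AbsGaloisGroupCompact
import Mathlib.FieldTheory.SeparableDegree
import HarnessLib

/-!
# Frobenius lifts in `Γ_F` for a non-archimedean local field (discharge of
`exists_isAbsArithFrob`, `exists_isFrobPow` of `LocalGaloisGroup.lean`; trunk GalRep, item C4)

D-0014 keeps `Literature/` sorry-free by stating cited results as named facts `def X : Prop`.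
This third sibling proof file of `Literature.NumberTheory.GaloisRepresentations.LocalGaloisGroup`
proves

* `Literature.exists_isAbsArithFrob_holds : ∃ σ : Γ_F, IsAbsArithFrob σ` — there is an arithmetic
  Frobenius in `Γ_F = Gal(F̄/F)` (`σ • x ≡ x ^ q_F (mod 𝔓)` on `S = absIntegers 𝒪[F] F`);
* `Literature.exists_isFrobPow_holds : ∀ n : ℤ, ∃ σ, IsFrobPow σ n` (its integer powers),

in **every characteristic**.  The decomposition group of the canonical prime `𝔓` is all of
`Γ_F` (`𝔓` is `Γ_F`-stable by construction) and `𝔓` is maximal (`LocalGaloisGroupHenselProofs`,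
the henselian input); Frobenius elements are produced by the profinite limit argument that
Mathlib provides as `Ideal.Quotient.stabilizerHom_surjective_of_profinite`, packaged in the tree
as `Literature.NumberTheory.GaloisRepresentations.exists_isArithFrobAt_of_isInvariant_of_profinite` (`IntegralGaloisActionProofs.lean`):
for a profinite group `G` acting continuously on a discrete ring `B` with ring of invariants `A`,
`G_Q ↠ Aut((B ⧸ Q)/(A ⧸ Q ∩ A))`, and `x ↦ x ^ #(A ⧸ Q ∩ A)` lifts.

The only subtlety is the ring of invariants.  In characteristic `0` it is `𝒪[F]`
(`Literature.NumberTheory.GaloisRepresentations.absIntegers.isInvariant`), but for an imperfect `F` (local fields of characteristic `p`)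
the fixed field of `Aut_F(F̄)` is the perfect closure of `F`, so `S^{Γ_F} ⊋ 𝒪[F]`.  We therefore
run the argument with `A = S^{Γ_F}` itself (`FixedPoints.subring`, trivially invariant) and show
that its residue field is still `𝓀[F]`: a `Γ_F`-fixed absolute integer `a` is purely inseparable
over `F` (`minpoly.natSepDegree_eq_one_iff_pow_mem`: all `F`-conjugates of `a` coincide), so
`a ^ (p ^ n) = c ∈ 𝒪[F]` for some `n`, and since `𝓀[F]` is perfect, `a ≡ d (mod 𝔓)` for the
`d ∈ 𝒪[F]` with `d ^ (p ^ n) ≡ c` (`residue_fixedPoint_mem_range`).  Hence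
`#(A ⧸ 𝔓 ∩ A) = #𝓀[F] = q_F` and the lifted automorphism is the arithmetic Frobenius of
`LocalGaloisGroup.lean` (`IsAbsArithFrob`, exponent `#(𝒪[F] ⧸ 𝔓 ∩ 𝒪[F]) = q_F`,
`card_quotient_under_absMaximalIdeal_holds`).  Compactness of `Γ_F` in characteristic `p` is
`Literature.NumberTheory.GaloisRepresentations.absoluteGaloisGroup_compactSpace` (`AbsGaloisGroupCompact.lean`).

## References

* J.-P. Serre, *Local Fields*, GTM 67, Springer 1979, Ch. I §7, Prop. 20–22, §8 (Frobenius
  substitution); Ch. II §3 (henselian case: `D_𝔓 = G`).  [SerreLocalFields1979]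
* J. Tate, *Number theoretic background*, Proc. Sympos. Pure Math. XXXIII (Corvallis 1977),
  Part 2, AMS 1979, (1.4.1).  [Corvallis1979]
* J. Neukirch, *Algebraic Number Theory*, Springer 1999, Ch. I §9, Prop. (9.4).
  [NeukirchANT1999]
-/

noncomputable section

open scoped Pointwise Valued
open ValuativeRel Field Polynomial

namespace Literature.NumberTheory.GaloisRepresentations

open GaloisRepresentations.IsNonarchimedeanLocalField

section FixedPoints

variable (F : Type*) [Field F]

/-- An element of `F̄` fixed by every `F`-automorphism is purely inseparable over `F`:
`x ^ (p ^ n) ∈ F` for some `n` (`p` the exponential characteristic), because the roots of its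
minimal polynomial — the images of `x` under the `F`-embeddings `F̄ → F̄`, all of which are
automorphisms — reduce to `x` alone.
Ref: Milne, *Fields and Galois Theory*, Ch. 7 (the fixed field of `Aut(Ω/F)` is the perfect
closure). [folklore] -/
theorem exists_pow_mem_range_of_forall_smul_eq (x : AlgebraicClosure F)
    (hx : ∀ σ : absoluteGaloisGroup F, σ • x = x) :
    ∃ n : ℕ, x ^ ringExpChar F ^ n ∈ (algebraMap F (AlgebraicClosure F)).range := by
  classical
  rw [← minpoly.natSepDegree_eq_one_iff_pow_mem (ringExpChar F),
    natSepDegree_eq_of_isAlgClosed (AlgebraicClosure F)]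
  -- the distinct roots of `minpoly F x` in `F̄` are the `ψ x`, `ψ : F̄ →ₐ[F] F̄`, all equal to `x`
  have hroots : ((minpoly F x).rootSet (AlgebraicClosure F)) = {x} := by
    rw [← Algebra.IsAlgebraic.range_eval_eq_rootSet_minpoly_of_splits (AlgebraicClosure F)
      (fun y => IsAlgClosed.splits _) x]
    ext y
    simp only [Set.mem_range, Set.mem_singleton_iff]
    constructor
    · rintro ⟨ψ, rfl⟩
      let e : AlgebraicClosure F ≃ₐ[F] AlgebraicClosure F :=
        AlgEquiv.ofBijective ψ (Algebra.IsAlgebraic.algHom_bijective ψ)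
      have := hx ((absoluteGaloisGroup.toAlgEquiv F).symm e)
      rw [absoluteGaloisGroup.toAlgEquiv_symm_apply] at this
      exact this
    · rintro rfl
      exact ⟨AlgHom.id F _, rfl⟩
  rw [rootSet_def] at hroots
  have h : ((minpoly F x).aroots (AlgebraicClosure F)).toFinset = {x} :=
    Finset.coe_injective (by simpa using hroots)
  rw [h, Finset.card_singleton]

variable [ValuativeRel F] [TopologicalSpace F] [IsNonarchimedeanLocalField F]

/-- The residue of a `Γ_F`-fixed absolute integer lies in `𝓀[F]`: for `a ∈ S` with `σ • a = a`
for all `σ ∈ Γ_F` there is `d ∈ 𝒪[F]` with `a - d ∈ 𝔓`.  (By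
`exists_pow_mem_range_of_forall_smul_eq`, `a ^ (p ^ n) = c ∈ 𝒪[F]`; as `𝓀[F]` is perfect,
`c ≡ d ^ (p ^ n)` for some `d ∈ 𝒪[F]`, and then `(a - d) ^ (p ^ n) ∈ 𝔓`.)
Ref: Serre, *Local Fields* (1979), Ch. II §4, Prop. 8 (perfect residue field). [folklore] -/
theorem exists_sub_algebraMap_mem_absMaximalIdeal_of_forall_smul_eq (a : absIntegers 𝒪[F] F)
    (ha : ∀ σ : absoluteGaloisGroup F, σ • a = a) :
    ∃ d : 𝒪[F], a - algebraMap 𝒪[F] (absIntegers 𝒪[F] F) d ∈ absMaximalIdeal F := by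
  set q := ringExpChar F with hq
  obtain ⟨n, c₀, hc₀⟩ := exists_pow_mem_range_of_forall_smul_eq F (a : AlgebraicClosure F)
    (fun σ => by rw [← integralClosure.coe_smul, ha σ])
  -- `c₀ ∈ 𝒪[F]`: it is integral over `𝒪[F]`
  have hcint : IsIntegral 𝒪[F] c₀ := by
    have h : IsIntegral 𝒪[F] (((a ^ q ^ n : absIntegers 𝒪[F] F)) : AlgebraicClosure F) :=
      (a ^ q ^ n).2
    rw [SubmonoidClass.coe_pow, ← hc₀] at h
    exact (isIntegral_algebraMap_iff (algebraMap F (AlgebraicClosure F)).injective).mp h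
  obtain ⟨c, hc⟩ := IsIntegrallyClosed.algebraMap_eq_of_integral hcint
  -- `a ^ (q ^ n) = c` in `S`
  have hac : a ^ q ^ n = algebraMap 𝒪[F] (absIntegers 𝒪[F] F) c := by
    apply Subtype.ext
    rw [SubmonoidClass.coe_pow, ← hc₀, ← hc, Subalgebra.coe_algebraMap,
      IsScalarTower.algebraMap_apply 𝒪[F] F (AlgebraicClosure F)]
  -- `𝓂[F] S ⊆ 𝔓`
  have hmP : ∀ m : 𝒪[F], m ∈ 𝓂[F] →
      algebraMap 𝒪[F] (absIntegers 𝒪[F] F) m ∈ absMaximalIdeal F := fun m hm =>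
    Ideal.le_radical (Ideal.mem_map_of_mem _ hm)
  rcases expChar_is_prime_or_one F q with hprime | h1
  · -- characteristic `p = q > 0`: Frobenius is bijective on the finite field `𝓀[F]`
    have hqF : (q : F) = 0 := by
      haveI := ringChar.charP F
      rcases CharP.char_is_prime_or_zero F (ringChar F) with hp | hp
      · rw [← (char_eq_expChar_iff F (ringChar F) q).mpr hp]
        exact ringChar.Nat.cast_ringChar
      · haveI : CharP F 0 := hp ▸ ringChar.charP F
        exact absurd (expChar_one_of_char_zero F q) hprime.one_lt.ne'
    have hq𝒪 : (q : 𝒪[F]) = 0 := Subtype.ext (by simpa using hqF)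
    have hq𝓀 : (q : 𝓀[F]) = 0 := by
      rw [← map_natCast (IsLocalRing.residue 𝒪[F]) q, hq𝒪, map_zero]
    haveI : CharP 𝓀[F] q := (CharP.charP_iff_prime_eq_zero hprime).mpr hq𝓀
    haveI : ExpChar 𝓀[F] q := .prime hprime
    -- `d ∈ 𝒪[F]` with `d ^ (q ^ n) ≡ c (mod 𝓂[F])`
    obtain ⟨y, hy⟩ := (iterateFrobeniusEquiv 𝓀[F] q n).surjective (IsLocalRing.residue 𝒪[F] c)
    obtain ⟨d, rfl⟩ := IsLocalRing.residue_surjective y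
    rw [iterateFrobeniusEquiv_apply, iterateFrobenius_def, ← map_pow] at hy
    have hy' : d ^ q ^ n - c ∈ 𝓂[F] := Ideal.Quotient.eq.mp hy
    refine ⟨d, ?_⟩
    -- `(a - d) ^ (q ^ n) = c - d ^ (q ^ n) ∈ 𝓂[F] S ⊆ 𝔓`
    haveI : ExpChar (AlgebraicClosure F) q :=
      expChar_of_injective_algebraMap (algebraMap F (AlgebraicClosure F)).injective q
    haveI : ExpChar (absIntegers 𝒪[F] F) q :=
      RingHom.expChar (algebraMap (absIntegers 𝒪[F] F) (AlgebraicClosure F))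
        Subtype.val_injective q
    refine Ideal.radical_isRadical _ ⟨q ^ n, ?_⟩
    change (a - _) ^ q ^ n ∈ absMaximalIdeal F
    rw [sub_pow_expChar_pow, hac, ← map_pow, ← map_sub, ← Ideal.neg_mem_iff, ← map_neg, neg_sub]
    exact hmP _ hy'
  · -- characteristic `0`: `q = 1`, `a = c`
    refine ⟨c, ?_⟩
    rw [← hac, h1, one_pow, pow_one, sub_self]
    exact zero_mem _

end FixedPoints

/-! ### Frobenius lifts -/

section Frobenius

variable (F : Type*) [Field F] [ValuativeRel F] [TopologicalSpace F] [IsNonarchimedeanLocalField F]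

/-- **Discharge of `exists_isAbsArithFrob`**: `Γ_F` contains an arithmetic Frobenius
(`σ • x ≡ x ^ q_F (mod 𝔓)` for all absolute integers `x`), in every characteristic.
Ref: Serre, *Local Fields* (1979), Ch. I §7, Prop. 20 and §8; Tate, Corvallis 1979, (1.4.1).
[cite: Corvallis1979, (1.4.1)] -/
theorem exists_isAbsArithFrob_holds : exists_isAbsArithFrob (F := F) := by
  classical
  set S := absIntegers 𝒪[F] F with hS
  set A : Subring S := FixedPoints.subring S (absoluteGaloisGroup F) with hA
  set P : Ideal A := (absMaximalIdeal F).under A with hP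
  haveI : Algebra.IsInvariant A S (absoluteGaloisGroup F) := ⟨fun b hb => ⟨⟨b, hb⟩, rfl⟩⟩
  -- the profinite group `Γ_F` acts continuously on the discrete ring `S`
  letI : TopologicalSpace S := ⊥
  haveI : DiscreteTopology S := ⟨rfl⟩
  haveI : ContinuousSMul (absoluteGaloisGroup F) S := absIntegers.continuousSMul 𝒪[F]
  haveI : CompactSpace (absoluteGaloisGroup F) := absoluteGaloisGroup_compactSpace F
  haveI h𝔓 : (absMaximalIdeal F).IsMaximal := absMaximalIdeal_isMaximal_holds F
  -- the embedding `𝒪[F] → A = S^{Γ_F}` (`σ • algebraMap r = algebraMap r`)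
  let ι : 𝒪[F] →+* A :=
    (algebraMap 𝒪[F] S).codRestrict _ fun r σ => smul_algebraMap σ r
  -- the residue ring `A ⧸ P` is `𝓀[F]`: the map `𝓀[F] → A ⧸ P` is bijective
  have hle : 𝓂[F] ≤ P.comap ι := fun m hm => by
    rw [Ideal.mem_comap, hP, Ideal.under_def, Ideal.mem_comap]
    exact Ideal.le_radical (Ideal.mem_map_of_mem _ hm)
  let φ : 𝓀[F] →+* A ⧸ P := Ideal.quotientMap P ι hle
  have hPne : P ≠ ⊤ := Ideal.comap_ne_top _ h𝔓.ne_top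
  haveI : Nontrivial (A ⧸ P) := Ideal.Quotient.nontrivial_iff.mpr hPne
  have hφ : Function.Bijective φ := by
    refine ⟨φ.injective, fun z => ?_⟩
    obtain ⟨⟨a, ha⟩, rfl⟩ := Ideal.Quotient.mk_surjective z
    obtain ⟨d, hd⟩ := exists_sub_algebraMap_mem_absMaximalIdeal_of_forall_smul_eq F a ha
    refine ⟨IsLocalRing.residue 𝒪[F] d, ?_⟩
    change Ideal.quotientMap P ι hle (Ideal.Quotient.mk _ d) = _
    rw [Ideal.quotientMap_mk, Ideal.Quotient.mk_eq_mk_iff_sub_mem]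
    rw [hP, Ideal.under_def, Ideal.mem_comap, map_sub, ← Ideal.neg_mem_iff, neg_sub]
    exact hd
  haveI : Finite (A ⧸ P) := Finite.of_surjective φ hφ.2
  obtain ⟨σ, hσ⟩ := exists_isArithFrobAt_of_isInvariant_of_profinite (A := A) (B := S)
    (G := absoluteGaloisGroup F) (absMaximalIdeal F)
  refine ⟨σ, fun x => ?_⟩
  have hcard : Nat.card (A ⧸ P) = Nat.card (𝒪[F] ⧸ (absMaximalIdeal F).under 𝒪[F]) := by
    rw [show Nat.card (𝒪[F] ⧸ (absMaximalIdeal F).under 𝒪[F]) = residueFieldCard F from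
      card_quotient_under_absMaximalIdeal_holds F]
    exact (Nat.card_eq_of_bijective φ hφ).symm
  rw [← hcard]
  exact hσ x

variable {F}

/-- Natural powers of a Frobenius power: `IsFrobPow σ n → IsFrobPow (σ ^ k) (k * n)`.
Ref: Tate, *Number theoretic background* (Corvallis 1979), (1.4.1). [folklore] -/
theorem IsFrobPow.pow {σ : absoluteGaloisGroup F} {n : ℤ} (h : IsFrobPow σ n) (k : ℕ) :
    IsFrobPow (σ ^ k) (k * n) := by
  induction k with
  | zero => simpa using (IsFrobPow.one (F := F))
  | succ k ih =>
    have := IsFrobPow.mul_holds ih h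
    rw [← pow_succ] at this
    convert this using 1
    push_cast
    ring

/-- Integer powers of a Frobenius power: `IsFrobPow σ n → IsFrobPow (σ ^ k) (k * n)` for
`k : ℤ`.  Ref: Tate, *Number theoretic background* (Corvallis 1979), (1.4.1). [folklore] -/
theorem IsFrobPow.zpow {σ : absoluteGaloisGroup F} {n : ℤ} (h : IsFrobPow σ n) (k : ℤ) :
    IsFrobPow (σ ^ k) (k * n) := by
  obtain ⟨k, rfl | rfl⟩ := k.eq_nat_or_neg
  · rw [zpow_natCast]
    exact h.pow k
  · rw [zpow_neg, zpow_natCast, neg_mul]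
    exact (h.pow k).inv

variable (F) in
/-- **Discharge of `exists_isFrobPow`**: every integer is the exponent of a Frobenius power
(powers of an arithmetic Frobenius), i.e. `deg : W_F → ℤ` is surjective.
Ref: Tate, *Number theoretic background* (Corvallis 1979), (1.4.1)–(1.4.4).
[cite: Corvallis1979, (1.4.1)] -/
theorem exists_isFrobPow_holds : exists_isFrobPow (F := F) := by
  intro n
  obtain ⟨σ, hσ⟩ := exists_isAbsArithFrob_holds F
  have h1 : IsFrobPow σ 1 := IsAbsArithFrob.isFrobPow_holds hσ
  exact ⟨σ ^ n, by simpa using h1.zpow n⟩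

end Frobenius



end Literature.NumberTheory.GaloisRepresentations
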